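import Summits.Parity.BatemanHorn.Theorems.SoloInformedHooleyUniformFrequency
import Summits.Parity.BatemanHorn.Theorems.SoloInformedHooleyMeanProfile

/-!
# Calibration at GROWING scales: the `ℓ¹` profile's `ε`-part holds up to `H ≤ ε^{-2/3}`

Informed soloist `solo-Parity-informed` (session 144), conjunct `BatemanHorn`, the `d ≥ 3` rung BELOW the parity
wall.  `SoloInformedHooleyProfileFixedScale` recorded that at every FIXED scale `H` the `ℓ¹` profile inequality
`∑_{1≤h≤H}(|T(h)| + |T(−h)|) ≤ ε·E` (`T(h) = ∑_{E<e≤E'} S_g(h;e)`) is a theorem (Hooley 1964, as proved in the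
tree).  With the frequency-uniform form of Hooley's explicit bound (`SoloInformedHooleyUniformFrequency`: the
constants depend on `g` only, the frequency costs a factor `√|h|`) the calibration extends to GROWING scales:

* `eventually_forall_norm_sum_polyRootWeylSum_le`: for `g` irreducible of degree `≥ 2` and every `c > 0`,
  for all large `x` and ALL `h ≠ 0` at once, `|∑_{k≤x} S_g(h,k)| ≤ c·√|h|·x` — Hooley's `o(x)`, uniformly in
  the frequency after division by `√|h|` (the tree's parameter choice `log z = log x/(ε log log x)`,
  `ε = δ/(2 log n)`, `t = 3(2 + δ/2)/ε`, run on the uniform bound);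
* `sum_norm_hooleySum_le_mul_pow_threeHalves`: for every `ε > 0` and `E ≥ E₀(ε)`, `E ≤ E' ≤ 2E` and EVERY `H`,
  `∑_{1≤h≤H}(|T(h)| + |T(−h)|) ≤ ε·H^{3/2}·E`;
* `sum_norm_hooleySum_growingScale_le`: for every `ε > 0` and `E ≥ E₀(ε)`, `E ≤ E' ≤ 2E`, and every scale with
  `H^{3/2} ≤ 1/ε`: `∑_{1≤h≤H}(|T(h)| + |T(−h)|) ≤ ε·E` — the `ℓ¹` profile inequality of `HooleyMeanProfile` with
  `C = 0` at all scales `H ≤ ε^{−2/3}`, a range that grows as `ε → 0`.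

Reading (prose, SHARPEST-STATEMENT §4.A of the line): quantitatively the tree's saving is
`(log log x)^{δ}(log x)^{−δ/2}` for an unspecified `0 < δ ≤ 1/2`, so the known region of the cubic profile is
`H ≤ (log E)^{c}` for some `c = c(g) > 0`, against the required `H ≤ E^{θ}`, `θ > 2/3`; and no argument bounding
`∑_e |S_g(h;e)|` with the absolute values inside (as every proof of Hooley's theorem does) passes `H ≈ log E`.
-/

namespace Summit.Parity.BatemanHorn.Theorems

open scoped BigOperators
open Finset Polynomial Filter Literature.NumberTheory.Sieve

/-- **Hooley's `o(x)`, uniformly in the frequency after division by `√|h|`.**  For `f ∈ ℤ[X]` irreducible of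
degree `≥ 2` and every `c > 0`: for all large `x` and all `h ≠ 0`, `|∑_{k≤x} S_f(h,k)| ≤ c·√|h|·x`.
(The tree's parameter choice in `hooley_polyRoots_equidistributed_holds`, verbatim, applied to the uniform explicit
bound `exists_norm_sum_polyRootWeylSum_le_sqrt_mul`; the parameters do not depend on `h`.) -/
theorem eventually_forall_norm_sum_polyRootWeylSum_le {f : ℤ[X]} (hirr : Irreducible f)
    (hdeg : 2 ≤ f.natDegree) {c : ℝ} (hc : 0 < c) :
    ∀ᶠ x : ℕ in atTop, ∀ h : ℤ, h ≠ 0 →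
      ‖∑ k ∈ Icc 1 x, polyRootWeylSum f k h‖ ≤ c * Real.sqrt (h.natAbs) * x := by
  obtain ⟨δ, hδ, hδ2, A₁, A₂, B, hA₁, hA₂, hB, hcore⟩ :=
    exists_norm_sum_polyRootWeylSum_le_sqrt_mul hirr hdeg
  set n : ℕ := f.natDegree with hn
  have hn2 : (2 : ℝ) ≤ n := by rw [hn]; exact_mod_cast hdeg
  have hn0 : (0 : ℝ) < n := by linarith
  have hlogn : 0 < Real.log n := Real.log_pos (by linarith)
  -- parameters
  set ε : ℝ := δ / (2 * Real.log n) with hε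
  have hε0 : 0 < ε := by positivity
  have hεn : Real.log n * ε = δ / 2 := by rw [hε]; field_simp
  set t : ℝ := 3 * (2 + δ / 2) / ε with ht
  have ht0 : 0 ≤ t := by positivity
  have htε : t / 3 * ε = 2 + δ / 2 := by rw [ht]; field_simp
  set A₂' : ℝ := A₂ * Real.exp (B * t * Real.exp t) with hA₂'
  have hA₂'0 : 0 ≤ A₂' := by positivity
  -- the limit function of `s = log log x`
  set Ψ : ℝ → ℝ := fun s => A₁ * ε ^ δ * (s ^ δ * Real.exp (-(δ / 2) * s)) +
    A₂' / ε * Real.exp (-s) with hΨ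
  have hΨ0 : Filter.Tendsto Ψ Filter.atTop (nhds 0) := by
    have h1 := (tendsto_rpow_mul_exp_neg_mul_atTop_nhds_zero δ (δ / 2) (by positivity)).const_mul
      (A₁ * ε ^ δ)
    have h2 := Real.tendsto_exp_neg_atTop_nhds_zero.const_mul (A₂' / ε)
    simpa [hΨ] using h1.add h2
  -- basic limits in `x`
  have hL : Filter.Tendsto (fun x : ℕ => Real.log (x : ℝ)) Filter.atTop Filter.atTop :=
    Real.tendsto_log_atTop.comp tendsto_natCast_atTop_atTop
  have hLL : Filter.Tendsto (fun x : ℕ => Real.log (Real.log (x : ℝ))) Filter.atTop Filter.atTop :=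
    Real.tendsto_log_atTop.comp hL
  -- the thresholds
  set c₁ : ℝ := max 2 (3 * t) with hc₁
  have hc₁0 : 0 < c₁ := lt_of_lt_of_le two_pos (le_max_left _ _)
  set s₀ : ℝ := max 1 (33 / ε) with hs₀
  have hev1 : ∀ᶠ x : ℕ in Filter.atTop, Ψ (Real.log (Real.log (x : ℝ))) ≤ c :=
    (hΨ0.comp hLL).eventually (Iic_mem_nhds hc)
  have hev2 : ∀ᶠ x : ℕ in Filter.atTop,
      ‖Real.log (Real.log (x : ℝ))‖ ≤ (1 / (ε * c₁)) * ‖Real.log (x : ℝ)‖ :=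
    hL.eventually (Real.isLittleO_log_id_atTop.bound (by positivity))
  have hev3 : ∀ᶠ x : ℕ in Filter.atTop, s₀ ≤ Real.log (Real.log (x : ℝ)) :=
    hLL.eventually_ge_atTop s₀
  have hev4 : ∀ᶠ x : ℕ in Filter.atTop, (3 : ℝ) ≤ Real.log (x : ℝ) := hL.eventually_ge_atTop 3
  filter_upwards [hev1, hev2, hev3, hev4] with x h1 h2 h3 h4
  -- notation
  set L : ℝ := Real.log (x : ℝ) with hLdef
  set s : ℝ := Real.log L with hsdef
  have hL0 : 0 < L := by linarith
  have hx1 : (1 : ℝ) < x := by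
    by_contra hle
    rw [not_lt] at hle
    have : L ≤ 0 := Real.log_nonpos (Nat.cast_nonneg x) hle
    linarith
  have hx0 : (0 : ℝ) < x := by linarith
  have hs1 : 1 ≤ s := le_trans (le_max_left _ _) h3
  have hs0 : 0 < s := by linarith
  have hs33 : 33 / ε ≤ s := le_trans (le_max_right _ _) h3
  have hexps : Real.exp s = L := by rw [hsdef, Real.exp_log hL0]
  set u : ℝ := L / (ε * s) with hudef
  have hεs0 : 0 < ε * s := by positivity
  have hu0 : 0 < u := by positivity
  have hLu : L / u = ε * s := by
    rw [hudef]; field_simp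
  -- `u ≥ c₁`, from `log L ≤ L/(ε c₁)`
  have huc : c₁ ≤ u := by
    have h2' : s ≤ (1 / (ε * c₁)) * L := by
      have := h2
      rw [Real.norm_of_nonneg hs0.le, Real.norm_of_nonneg hL0.le] at this
      exact this
    rw [hudef, le_div_iff₀ hεs0]
    calc c₁ * (ε * s) ≤ c₁ * (ε * ((1 / (ε * c₁)) * L)) := by gcongr
      _ = L := by field_simp
  have hu2 : 2 ≤ u := le_trans (le_max_left _ _) huc
  have hu3t : 3 * t ≤ u := le_trans (le_max_right _ _) huc
  -- the parameter `z = e^u`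
  set z : ℝ := Real.exp u with hzdef
  have hlogz : Real.log z = u := by rw [hzdef, Real.log_exp]
  have hz4 : 4 ≤ z := by
    rw [hzdef]
    have h22 : Real.exp 2 ≤ Real.exp u := Real.exp_le_exp.2 hu2
    have : (4 : ℝ) ≤ Real.exp 2 := by
      have := Real.add_one_le_exp (1 : ℝ)
      have h' : Real.exp 2 = Real.exp 1 * Real.exp 1 := by rw [← Real.exp_add]; norm_num
      nlinarith [Real.exp_pos (1 : ℝ)]
    linarith
  -- the absorption condition `z^10 log z ≤ x^{1/3}`
  have hcond : z ^ (10 : ℕ) * Real.log z ≤ (x : ℝ) ^ ((1 : ℝ) / 3) := by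
    rw [hlogz, hzdef, ← Real.exp_nat_mul, Real.rpow_def_of_pos hx0, ← hLdef]
    have hu_exp : u ≤ Real.exp u := by linarith [Real.add_one_le_exp u]
    calc Real.exp ((10 : ℕ) * u) * u ≤ Real.exp ((10 : ℕ) * u) * Real.exp u :=
          mul_le_mul_of_nonneg_left hu_exp (Real.exp_pos _).le
      _ = Real.exp (11 * u) := by rw [← Real.exp_add]; push_cast; ring_nf
      _ ≤ Real.exp (L * (1 / 3)) := by
          rw [Real.exp_le_exp, hudef]
          have h33 : 33 ≤ ε * s := by
            rw [div_le_iff₀ hε0] at hs33; linarith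
          rw [show 11 * (L / (ε * s)) = L * (11 / (ε * s)) by ring]
          refine mul_le_mul_of_nonneg_left ?_ hL0.le
          rw [div_le_iff₀ hεs0]
          linarith
  intro h hh
  -- apply the main estimate (uniform in `h`)
  have hb := hcore h hh x z t hz4 ht0 (by rw [hlogz]; exact hu3t) hcond
  rw [hlogz, hLu] at hb
  -- identify the two terms
  have hΞ : (n : ℝ) ^ (ε * s) = Real.exp (δ / 2 * s) := by
    rw [Real.rpow_def_of_pos hn0, ← mul_assoc, hεn]
  have hT1 : (n : ℝ) ^ (ε * s) * (A₁ * u ^ (-δ)) =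
      A₁ * ε ^ δ * (s ^ δ * Real.exp (-(δ / 2) * s)) := by
    rw [hΞ, hudef, Real.rpow_def_of_pos hu0, Real.log_div hL0.ne' hεs0.ne', ← hsdef]
    have e1 : ε ^ δ * s ^ δ = Real.exp (Real.log (ε * s) * δ) := by
      rw [← Real.mul_rpow hε0.le hs0.le, Real.rpow_def_of_pos hεs0]
    calc Real.exp (δ / 2 * s) * (A₁ * Real.exp ((s - Real.log (ε * s)) * -δ))
        = A₁ * (Real.exp (Real.log (ε * s) * δ) * Real.exp (-(δ / 2) * s)) := by
          rw [mul_comm (Real.exp (δ / 2 * s)), mul_assoc, ← Real.exp_add, ← Real.exp_add]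
          congr 2
          ring
      _ = A₁ * ε ^ δ * (s ^ δ * Real.exp (-(δ / 2) * s)) := by rw [← e1]; ring
  have hT2 : (n : ℝ) ^ (ε * s) * (A₂ * Real.exp (B * t * Real.exp t) * u *
      Real.exp (-(t / 3) * (ε * s))) = A₂' / (ε * s) * Real.exp (-s) := by
    rw [hΞ, hA₂', hudef, ← hexps]
    have e1 : -(t / 3) * (ε * s) = -((t / 3 * ε) * s) := by ring
    rw [e1, htε]
    calc Real.exp (δ / 2 * s) * (A₂ * Real.exp (B * t * Real.exp t) * (Real.exp s / (ε * s)) *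
          Real.exp (-((2 + δ / 2) * s)))
        = A₂ * Real.exp (B * t * Real.exp t) / (ε * s) *
            (Real.exp (δ / 2 * s) * Real.exp s * Real.exp (-((2 + δ / 2) * s))) := by ring
      _ = A₂ * Real.exp (B * t * Real.exp t) / (ε * s) * Real.exp (-s) := by
          rw [← Real.exp_add, ← Real.exp_add]
          congr 2
          ring
  have hT2le : A₂' / (ε * s) * Real.exp (-s) ≤ A₂' / ε * Real.exp (-s) := by
    refine mul_le_mul_of_nonneg_right ?_ (Real.exp_pos _).le
    refine div_le_div_of_nonneg_left hA₂'0 hε0 ?_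
    calc ε = ε * 1 := (mul_one ε).symm
      _ ≤ ε * s := mul_le_mul_of_nonneg_left hs1 hε0.le
  -- conclude
  have hsq0 : 0 ≤ Real.sqrt (h.natAbs) := Real.sqrt_nonneg _
  have hinner : (n : ℝ) ^ (ε * s) * x * (A₁ * u ^ (-δ) +
      A₂ * Real.exp (B * t * Real.exp t) * u * Real.exp (-(t / 3) * (ε * s))) ≤ c * x := by
    calc (n : ℝ) ^ (ε * s) * x * (A₁ * u ^ (-δ) +
          A₂ * Real.exp (B * t * Real.exp t) * u * Real.exp (-(t / 3) * (ε * s)))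
        = x * ((n : ℝ) ^ (ε * s) * (A₁ * u ^ (-δ)) + (n : ℝ) ^ (ε * s) *
            (A₂ * Real.exp (B * t * Real.exp t) * u * Real.exp (-(t / 3) * (ε * s)))) := by ring
      _ = x * (A₁ * ε ^ δ * (s ^ δ * Real.exp (-(δ / 2) * s)) + A₂' / (ε * s) * Real.exp (-s)) := by
          rw [hT1, hT2]
      _ ≤ x * Ψ s := by
          refine mul_le_mul_of_nonneg_left ?_ hx0.le
          simp only [hΨ]
          linarith
      _ ≤ x * c := mul_le_mul_of_nonneg_left h1 hx0.le
      _ = c * x := mul_comm _ _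
  calc ‖∑ d ∈ Icc 1 x, polyRootWeylSum f d h‖
      ≤ Real.sqrt (h.natAbs) * ((n : ℝ) ^ (ε * s) * x * (A₁ * u ^ (-δ) +
          A₂ * Real.exp (B * t * Real.exp t) * u * Real.exp (-(t / 3) * (ε * s)))) := hb
    _ ≤ Real.sqrt (h.natAbs) * (c * x) := mul_le_mul_of_nonneg_left hinner hsq0
    _ = c * Real.sqrt (h.natAbs) * x := by ring

variable {g : ℤ[X]}

/-- **The `ℓ¹` profile quantity at every scale, with the loss `H^{3/2}`.**  For `g` irreducible of degree `≥ 2`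
and `ε > 0`: for `E ≥ E₀(ε)`, `E ≤ E' ≤ 2E` and every `H`,
`∑_{1≤h≤H}(|T(h)| + |T(−h)|) ≤ ε·H^{3/2}·E`, `T(h) = ∑_{E<e≤E'} S_g(h;e)`
(each `|T(±h)| ≤ |R(±h,E')| + |R(±h,E)| ≤ (ε/6)√h·3E` and `∑_{h≤H} √h ≤ H√H`). -/
theorem sum_norm_hooleySum_le_mul_pow_threeHalves (hirr : Irreducible g) (hdeg : 2 ≤ g.natDegree)
    {ε : ℝ} (hε : 0 < ε) :
    ∃ E₀ : ℕ, ∀ E E' H : ℕ, E₀ ≤ E → E ≤ E' → E' ≤ 2 * E →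
      ∑ h ∈ Icc 1 H, (‖∑ e ∈ Ioc E E', hooleySum g e h‖ +
        ‖∑ e ∈ Ioc E E', hooleySum g e (-(h : ℤ))‖) ≤ ε * ((H : ℝ) * Real.sqrt H) * E := by
  have hc : 0 < ε / 6 := by positivity
  obtain ⟨E₀, hE₀⟩ := eventually_atTop.1 (eventually_forall_norm_sum_polyRootWeylSum_le hirr hdeg hc)
  refine ⟨E₀, fun E E' H hE hEE' hE'2 => ?_⟩
  have hE' : E₀ ≤ E' := hE.trans hEE'
  have hEr : (E : ℝ) ≤ E' := by exact_mod_cast hEE'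
  have hE'r : (E' : ℝ) ≤ 2 * E := by exact_mod_cast hE'2
  have hE0 : (0 : ℝ) ≤ E := Nat.cast_nonneg E
  -- one frequency
  have one : ∀ h : ℤ, h ≠ 0 →
      ‖∑ e ∈ Ioc E E', hooleySum g e h‖ ≤ ε / 2 * Real.sqrt (h.natAbs) * E := by
    intro h hh
    have h1 := hE₀ E' hE' h hh
    have h2 := hE₀ E hE h hh
    have hs0 : 0 ≤ Real.sqrt (h.natAbs) := Real.sqrt_nonneg _
    calc ‖∑ e ∈ Ioc E E', hooleySum g e h‖
        ≤ ‖∑ k ∈ Icc 1 E', polyRootWeylSum g k h‖ + ‖∑ k ∈ Icc 1 E, polyRootWeylSum g k h‖ :=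
          norm_sum_Ioc_hooleySum_le_add g h hEE'
      _ ≤ ε / 6 * Real.sqrt (h.natAbs) * E' + ε / 6 * Real.sqrt (h.natAbs) * E := add_le_add h1 h2
      _ ≤ ε / 6 * Real.sqrt (h.natAbs) * (2 * E) + ε / 6 * Real.sqrt (h.natAbs) * E := by
          have : 0 ≤ ε / 6 * Real.sqrt (h.natAbs) := by positivity
          nlinarith
      _ = ε / 2 * Real.sqrt (h.natAbs) * E := by ring
  -- sum over the scale
  have hterm : ∀ h ∈ Icc 1 H, (‖∑ e ∈ Ioc E E', hooleySum g e h‖ +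
      ‖∑ e ∈ Ioc E E', hooleySum g e (-(h : ℤ))‖) ≤ ε * Real.sqrt H * E := by
    intro h hh
    have hh1 : 1 ≤ h := (mem_Icc.1 hh).1
    have hhH : h ≤ H := (mem_Icc.1 hh).2
    have hne : (h : ℤ) ≠ 0 := by exact_mod_cast (show h ≠ 0 by omega)
    have hne' : (-(h : ℤ)) ≠ 0 := neg_ne_zero.2 hne
    have habs : ((h : ℤ)).natAbs = h := Int.natAbs_natCast h
    have habs' : (-(h : ℤ)).natAbs = h := by rw [Int.natAbs_neg, Int.natAbs_natCast]
    have hsq : Real.sqrt (h : ℝ) ≤ Real.sqrt H := Real.sqrt_le_sqrt (by exact_mod_cast hhH)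
    have h1 := one (h : ℤ) hne
    have h2 := one (-(h : ℤ)) hne'
    rw [habs] at h1
    rw [habs'] at h2
    have : 0 ≤ ε / 2 * E := by positivity
    calc ‖∑ e ∈ Ioc E E', hooleySum g e h‖ + ‖∑ e ∈ Ioc E E', hooleySum g e (-(h : ℤ))‖
        ≤ ε / 2 * Real.sqrt (h : ℝ) * E + ε / 2 * Real.sqrt (h : ℝ) * E := add_le_add h1 h2
      _ = ε * E * Real.sqrt (h : ℝ) := by ring
      _ ≤ ε * E * Real.sqrt H := mul_le_mul_of_nonneg_left hsq (by positivity)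
      _ = ε * Real.sqrt H * E := by ring
  calc ∑ h ∈ Icc 1 H, (‖∑ e ∈ Ioc E E', hooleySum g e h‖ + ‖∑ e ∈ Ioc E E', hooleySum g e (-(h : ℤ))‖)
      ≤ ∑ h ∈ Icc 1 H, ε * Real.sqrt H * E := Finset.sum_le_sum hterm
    _ = (H : ℝ) * (ε * Real.sqrt H * E) := by
        rw [Finset.sum_const, Nat.card_Icc, nsmul_eq_mul]
        push_cast
        ring
    _ = ε * ((H : ℝ) * Real.sqrt H) * E := by ring

/-- **Calibration at growing scales.**  For `g` irreducible of degree `≥ 2` and `ε > 0`: for `E ≥ E₀(ε)`,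
`E ≤ E' ≤ 2E` and every scale `H` with `H^{3/2} ≤ 1/ε`, the `ℓ¹` profile inequality of `HooleyMeanProfile` holds
with `C = 0`: `∑_{1≤h≤H}(|T(h)| + |T(−h)|) ≤ ε·E`.  The admissible range `H ≤ ε^{−2/3}` grows as `ε → 0`; the OPEN
content of the profile is the range up to `H = E^{θ}`. -/
theorem sum_norm_hooleySum_growingScale_le (hirr : Irreducible g) (hdeg : 2 ≤ g.natDegree)
    {ε : ℝ} (hε : 0 < ε) :
    ∃ E₀ : ℕ, ∀ E E' H : ℕ, E₀ ≤ E → E ≤ E' → E' ≤ 2 * E →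
      (H : ℝ) * Real.sqrt H ≤ 1 / ε →
      ∑ h ∈ Icc 1 H, (‖∑ e ∈ Ioc E E', hooleySum g e h‖ +
        ‖∑ e ∈ Ioc E E', hooleySum g e (-(h : ℤ))‖) ≤ ε * E := by
  have hε2 : 0 < ε ^ 2 := by positivity
  obtain ⟨E₀, hE₀⟩ := sum_norm_hooleySum_le_mul_pow_threeHalves hirr hdeg hε2
  refine ⟨E₀, fun E E' H hE hEE' hE'2 hH => (hE₀ E E' H hE hEE' hE'2).trans ?_⟩
  have hE0 : (0 : ℝ) ≤ E := Nat.cast_nonneg E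
  have hprod : ε ^ 2 * ((H : ℝ) * Real.sqrt H) ≤ ε := by
    calc ε ^ 2 * ((H : ℝ) * Real.sqrt H) ≤ ε ^ 2 * (1 / ε) :=
          mul_le_mul_of_nonneg_left hH hε2.le
      _ = ε := by field_simp
  exact mul_le_mul_of_nonneg_right hprod hE0

end Summit.Parity.BatemanHorn.Theorems
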